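import Mathlib.RingTheory.Valuation.ValuationSubring
import Mathlib.RingTheory.LocalRing.MaximalIdeal.Basic
import Mathlib.Algebra.BigOperators.Group.Finset.Basic
import HarnessLib

/-!
# Adapted very good charts along a valuation of higher rank (definitions)

Crux `Valuative.LuAlphaPTorsor` (stmt-ResolutionOfSingularities-0641), line `pfaff-line-log-final-forms`,
lead seat c4 — the two predicates posited by the attack on the open core
`stub_abhyankarHigherRankCore` (the crux along zero-dimensional Abhyankar places of RANK ≥ 2):
the rank-one proof (`stub_rankOneAbhyankar`, `…Theorems.ValuativeLuAlphaPTorsorRankOne`) runs on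
VERY GOOD CHARTS `(R, x)` (finitely generated `R ⊆ O`, parameters `x₁..xₙ ∈ R ∖ 0` generating the
centre `𝔪_O ∩ R`, with `ℤ`-independent values); in rank `≥ 2` the Perron monomialization has to
be run level by level on the coarsenings of `O`, which requires the chart to be ADAPTED to the
flag of convex subgroups of the value lattice. Both predicates are phrased with `O.valuation`
alone (no coarsening, no residue field):

* `AdaptedValues τ lv` — for a family of values `τ : Fin n → Γ₀` and a level map
  `lv : Fin n → ℕ` (level `0` = the LEAST infinitesimal parameters): (C2a) a parameter of higher
  level is smaller than every Laurent monomial in parameters of lower-or-equal level than a given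
  lower one; (C2b) two parameters of the same level are archimedean-comparable; (C4) a non-trivial
  Laurent monomial in the parameters of one level `ℓ` is either smaller or larger than EVERY
  Laurent monomial in the parameters of level `< ℓ` (the level-`ℓ` lattice injects into the
  quotient by the convex hull of the lower levels — not a consequence of (C2): e.g. values
  `(0,1), (1,0), (2,√3)` in `ℝ ×ₗ ℝ`).
* `AdaptedChart O R hRO x hx lv` — `R.FG`, `xᵢ ≠ 0`, `(x) = 𝔪_O ∩ R`, independent values,
  `AdaptedValues (v ∘ x) lv`, and (C3): for every `ℓ`, the ideal of `R` generated by the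
  parameters of level `≥ ℓ` is exactly the set of `z ∈ R` whose value is smaller than every
  Laurent monomial in the parameters of level `< ℓ` (= the centre on `R` of the coarsening of `O`
  in which the lower levels become units). For `ℓ = 0` this is the centre condition again.

[folklore] (Zariski 1940 / Cutkosky 2022 §4: "very good parameters" adapted to the composite
structure `P_{t-i}(R) = (z_j : j > s_i)`.)
-/

set_option linter.dupNamespace false

open IsLocalRing

namespace Summit.ResolutionOfSingularities.ResolutionOfSingularities.Theorems.PfaffLine

/-- **Adapted family of values** `τ` with level map `lv` (level `0` = least infinitesimal):
(C2a) `lv i < lv i' ⇒ τ i' < τ^m` for every `m` supported on levels `≤ lv i`;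
(C2b) `lv i = lv i' ⇒ τ i ^ N < τ i'` for some `N`;
(C4) for `μ ≠ 0` supported on one level `ℓ`, `τ^μ` is smaller than all `τ^m`, `m` supported on
levels `< ℓ`, or larger than all of them. [folklore] -/
def AdaptedValues {Γ₀ : Type} [LinearOrderedCommGroupWithZero Γ₀] {n : ℕ} (τ : Fin n → Γ₀)
    (lv : Fin n → ℕ) : Prop :=
  (∀ i i', lv i < lv i' → ∀ m : Fin n → ℤ, (∀ j, lv i < lv j → m j = 0) →
      τ i' < ∏ j, τ j ^ (m j)) ∧
  (∀ i i', lv i = lv i' → ∃ N : ℕ, τ i ^ N < τ i') ∧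
  (∀ (ℓ : ℕ) (μ : Fin n → ℤ), (∀ j, lv j ≠ ℓ → μ j = 0) → μ ≠ 0 →
      (∀ m : Fin n → ℤ, (∀ j, ℓ ≤ lv j → m j = 0) → (∏ j, τ j ^ (μ j)) < ∏ j, τ j ^ (m j)) ∨
      (∀ m : Fin n → ℤ, (∀ j, ℓ ≤ lv j → m j = 0) → (∏ j, τ j ^ (m j)) < ∏ j, τ j ^ (μ j)))

/-- **Adapted very good chart** of `K` along `O` with parameters `x` and level map `lv`:
`R` finitely generated, `xᵢ ≠ 0`, the `xᵢ` generate the centre `𝔪_O ∩ R`, their values are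
`ℤ`-independent and adapted (`AdaptedValues`), and (C3) for every level `ℓ` the parameters of
level `≥ ℓ` generate the ideal of elements of `R` smaller in value than every Laurent monomial in
the parameters of level `< ℓ`. [folklore] -/
def AdaptedChart {k K : Type} [Field k] [Field K] [Algebra k K] (O : ValuationSubring K) {n : ℕ}
    (R : Subalgebra k K) (hRO : R.toSubring ≤ O.toSubring) (x : Fin n → K) (hx : ∀ i, x i ∈ R)
    (lv : Fin n → ℕ) : Prop :=
  R.FG ∧ (∀ i, x i ≠ 0) ∧
  Ideal.span (Set.range fun i => (⟨x i, hx i⟩ : R.toSubring)) =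
    Ideal.comap (Subring.inclusion hRO) (maximalIdeal O) ∧
  (∀ m : Fin n → ℤ, (∏ i, O.valuation (x i) ^ (m i)) = 1 → m = 0) ∧
  AdaptedValues (fun i => O.valuation (x i)) lv ∧
  (∀ (ℓ : ℕ) (z : R.toSubring),
    z ∈ Ideal.span (Set.range fun i : {i : Fin n // ℓ ≤ lv i} => (⟨x i.1, hx i.1⟩ : R.toSubring)) ↔
      ∀ m : Fin n → ℤ, (∀ j, ℓ ≤ lv j → m j = 0) →
        O.valuation (z : K) < ∏ j, O.valuation (x j) ^ (m j))

/-- Unfolding `AdaptedChart` into its six clauses. [folklore] -/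
theorem adaptedChart_iff {k K : Type} [Field k] [Field K] [Algebra k K] (O : ValuationSubring K)
    {n : ℕ} (R : Subalgebra k K) (hRO : R.toSubring ≤ O.toSubring) (x : Fin n → K)
    (hx : ∀ i, x i ∈ R) (lv : Fin n → ℕ) :
    AdaptedChart O R hRO x hx lv ↔
      R.FG ∧ (∀ i, x i ≠ 0) ∧
      Ideal.span (Set.range fun i => (⟨x i, hx i⟩ : R.toSubring)) =
        Ideal.comap (Subring.inclusion hRO) (maximalIdeal O) ∧
      (∀ m : Fin n → ℤ, (∏ i, O.valuation (x i) ^ (m i)) = 1 → m = 0) ∧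
      AdaptedValues (fun i => O.valuation (x i)) lv ∧
      (∀ (ℓ : ℕ) (z : R.toSubring),
        z ∈ Ideal.span (Set.range
            fun i : {i : Fin n // ℓ ≤ lv i} => (⟨x i.1, hx i.1⟩ : R.toSubring)) ↔
          ∀ m : Fin n → ℤ, (∀ j, ℓ ≤ lv j → m j = 0) →
            O.valuation (z : K) < ∏ j, O.valuation (x j) ^ (m j)) :=
  Iff.rfl

/-- Unfolding `AdaptedValues` into its three clauses. [folklore] -/
theorem adaptedValues_iff {Γ₀ : Type} [LinearOrderedCommGroupWithZero Γ₀] {n : ℕ}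
    (τ : Fin n → Γ₀) (lv : Fin n → ℕ) :
    AdaptedValues τ lv ↔
      (∀ i i', lv i < lv i' → ∀ m : Fin n → ℤ, (∀ j, lv i < lv j → m j = 0) →
          τ i' < ∏ j, τ j ^ (m j)) ∧
      (∀ i i', lv i = lv i' → ∃ N : ℕ, τ i ^ N < τ i') ∧
      (∀ (ℓ : ℕ) (μ : Fin n → ℤ), (∀ j, lv j ≠ ℓ → μ j = 0) → μ ≠ 0 →
          (∀ m : Fin n → ℤ, (∀ j, ℓ ≤ lv j → m j = 0) → (∏ j, τ j ^ (μ j)) < ∏ j, τ j ^ (m j)) ∨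
          (∀ m : Fin n → ℤ, (∀ j, ℓ ≤ lv j → m j = 0) → (∏ j, τ j ^ (m j)) < ∏ j, τ j ^ (μ j))) :=
  Iff.rfl

/-- An adapted chart is in particular a very good chart: its parameters generate the centre.
[folklore] -/
theorem AdaptedChart.span_eq {k K : Type} [Field k] [Field K] [Algebra k K] {O : ValuationSubring K}
    {n : ℕ} {R : Subalgebra k K} {hRO : R.toSubring ≤ O.toSubring} {x : Fin n → K}
    {hx : ∀ i, x i ∈ R} {lv : Fin n → ℕ} (h : AdaptedChart O R hRO x hx lv) :
    Ideal.span (Set.range fun i => (⟨x i, hx i⟩ : R.toSubring)) =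
      Ideal.comap (Subring.inclusion hRO) (maximalIdeal O) :=
  h.2.2.1

/-- The values of the parameters of an adapted chart are `ℤ`-independent. [folklore] -/
theorem AdaptedChart.valIndep {k K : Type} [Field k] [Field K] [Algebra k K] {O : ValuationSubring K}
    {n : ℕ} {R : Subalgebra k K} {hRO : R.toSubring ≤ O.toSubring} {x : Fin n → K}
    {hx : ∀ i, x i ∈ R} {lv : Fin n → ℕ} (h : AdaptedChart O R hRO x hx lv) :
    ∀ m : Fin n → ℤ, (∏ i, O.valuation (x i) ^ (m i)) = 1 → m = 0 :=
  h.2.2.2.1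

/-- A Laurent monomial in non-zero elements has non-zero value (registered sub-goal of the
adapted-chart layer; used throughout the level calculus). [folklore] -/
theorem adapted_prod_zpow_valuation_ne_zero : ∀ (K : Type) [Field K] (O : ValuationSubring K) (n : ℕ) (x : Fin n → K), (∀ i, x i ≠ 0) → ∀ m : Fin n → ℤ, (∏ i, O.valuation (x i) ^ (m i)) ≠ 0 := by
  intro K _ O n x hx m
  exact Finset.prod_ne_zero_iff.mpr fun i _ => zpow_ne_zero _ ((map_ne_zero O.valuation).mpr (hx i))

/-! ### The flag-adapted (lattice-archimedean) refinement

Worker w-F4a (wave 2) observed that clause (C2b) of `AdaptedValues` — archimedean comparability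
of the PARAMETERS of one level — does not exclude a hidden archimedean class inside the lattice
of a level (values `(1,0), (1,1)` in `ℤ² lex`: `2(1,0) > (1,1) > (1,0)` passes (C2b) but `Y/X`
is infinitely small against `X`), so that the coarsening making the lower levels units need not
be of rank one. The predicates actually used by the level induction add the LATTICE form of
(C2b): -/

/-- **Lattice-archimedean levels**: for `μ, μ'` supported on one level `ℓ` with `τ^μ` smaller
than every `τ^m`, `m` supported on the levels `< ℓ`, some power `(τ^μ)^N` lies below `τ^μ'`
(the lattice of level `ℓ` is ONE archimedean class modulo the lower levels). [folklore] -/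
def LevelArchimedean {Γ₀ : Type} [LinearOrderedCommGroupWithZero Γ₀] {n : ℕ} (τ : Fin n → Γ₀)
    (lv : Fin n → ℕ) : Prop :=
  ∀ (ℓ : ℕ) (μ μ' : Fin n → ℤ), (∀ j, lv j ≠ ℓ → μ j = 0) → (∀ j, lv j ≠ ℓ → μ' j = 0) →
    (∀ m : Fin n → ℤ, (∀ j, ℓ ≤ lv j → m j = 0) → (∏ j, τ j ^ (μ j)) < ∏ j, τ j ^ (m j)) →
    ∃ N : ℕ, (∏ j, τ j ^ (μ j)) ^ N < ∏ j, τ j ^ (μ' j)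

/-- **Flag-adapted family of values** = `AdaptedValues` ∧ `LevelArchimedean`: the levels are
exactly the archimedean classes of the value lattice (the flag of its convex subgroups).
[folklore] -/
def FlagAdaptedValues {Γ₀ : Type} [LinearOrderedCommGroupWithZero Γ₀] {n : ℕ} (τ : Fin n → Γ₀)
    (lv : Fin n → ℕ) : Prop :=
  AdaptedValues τ lv ∧ LevelArchimedean τ lv

/-- **Flag-adapted very good chart** = `AdaptedChart` ∧ `LevelArchimedean (v ∘ x) lv` — the
notion used by the rank `≥ 2` stubs (reshape v6.3). [folklore] -/
def FlagAdaptedChart {k K : Type} [Field k] [Field K] [Algebra k K] (O : ValuationSubring K) {n : ℕ}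
    (R : Subalgebra k K) (hRO : R.toSubring ≤ O.toSubring) (x : Fin n → K) (hx : ∀ i, x i ∈ R)
    (lv : Fin n → ℕ) : Prop :=
  AdaptedChart O R hRO x hx lv ∧ LevelArchimedean (fun i => O.valuation (x i)) lv

/-- Unfolding `FlagAdaptedChart`. [folklore] -/
theorem flagAdaptedChart_iff {k K : Type} [Field k] [Field K] [Algebra k K] (O : ValuationSubring K)
    {n : ℕ} (R : Subalgebra k K) (hRO : R.toSubring ≤ O.toSubring) (x : Fin n → K)
    (hx : ∀ i, x i ∈ R) (lv : Fin n → ℕ) :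
    FlagAdaptedChart O R hRO x hx lv ↔
      AdaptedChart O R hRO x hx lv ∧ LevelArchimedean (fun i => O.valuation (x i)) lv :=
  Iff.rfl

/-- Unfolding `FlagAdaptedValues`. [folklore] -/
theorem flagAdaptedValues_iff {Γ₀ : Type} [LinearOrderedCommGroupWithZero Γ₀] {n : ℕ}
    (τ : Fin n → Γ₀) (lv : Fin n → ℕ) :
    FlagAdaptedValues τ lv ↔ AdaptedValues τ lv ∧ LevelArchimedean τ lv :=
  Iff.rfl

/-- Unfolding `LevelArchimedean`. [folklore] -/
theorem levelArchimedean_iff {Γ₀ : Type} [LinearOrderedCommGroupWithZero Γ₀] {n : ℕ}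
    (τ : Fin n → Γ₀) (lv : Fin n → ℕ) :
    LevelArchimedean τ lv ↔
      ∀ (ℓ : ℕ) (μ μ' : Fin n → ℤ), (∀ j, lv j ≠ ℓ → μ j = 0) → (∀ j, lv j ≠ ℓ → μ' j = 0) →
        (∀ m : Fin n → ℤ, (∀ j, ℓ ≤ lv j → m j = 0) → (∏ j, τ j ^ (μ j)) < ∏ j, τ j ^ (m j)) →
        ∃ N : ℕ, (∏ j, τ j ^ (μ j)) ^ N < ∏ j, τ j ^ (μ' j) :=
  Iff.rfl

/-- A flag-adapted chart is an adapted chart. [folklore] -/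
theorem FlagAdaptedChart.adaptedChart {k K : Type} [Field k] [Field K] [Algebra k K]
    {O : ValuationSubring K} {n : ℕ} {R : Subalgebra k K} {hRO : R.toSubring ≤ O.toSubring}
    {x : Fin n → K} {hx : ∀ i, x i ∈ R} {lv : Fin n → ℕ} (h : FlagAdaptedChart O R hRO x hx lv) :
    AdaptedChart O R hRO x hx lv :=
  h.1

/-- The flag-adapted values of a flag-adapted chart. [folklore] -/
theorem FlagAdaptedChart.flagAdaptedValues {k K : Type} [Field k] [Field K] [Algebra k K]
    {O : ValuationSubring K} {n : ℕ} {R : Subalgebra k K} {hRO : R.toSubring ≤ O.toSubring}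
    {x : Fin n → K} {hx : ∀ i, x i ∈ R} {lv : Fin n → ℕ} (h : FlagAdaptedChart O R hRO x hx lv) :
    FlagAdaptedValues (fun i => O.valuation (x i)) lv :=
  ⟨h.1.2.2.2.2.1, h.2⟩

end Summit.ResolutionOfSingularities.ResolutionOfSingularities.Theorems.PfaffLine
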